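import Summits.QuantumAdvantage.AdviceFreeQNC0.TwoWindowCharacters
import Summits.QuantumAdvantage.AdviceFreeQNC0.TripleResidueElimination
import Summits.QuantumAdvantage.AdviceFreeQNC0.OneWindowStrategies
import HarnessLib

/-!
# Cell qa-qnc0 (rung F-Q1, route RingFrame, crux α `RingToElim`): ring strategies supported on the
# two ends and TWO interior windows are hard

The third unconditional special case of the crux α (`RingHardU` in walk coordinates), after
`EndSupportedStrategies.lean` (no interior position) and `OneWindowStrategies.lean` (one window).
Let `n = L₀ + (L₁ + L₂)` with the three blocks large and polynomially balanced
(`log₂ n ≤ 2 log₂ min(L₀, L₁, L₂)`), `K ≤ (log₂ n)^C`, and let the walk strategy `y` (selectors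
of degree `≤ (log₂ n)^C`) select only positions in the left end `{g < K}`, the windows
`[L₀, L₀ + K)`, `[L₀ + L₁, L₀ + L₁ + K)` and the right end `{g > n − K}`.  Then for every charge
the ring game is won on at most `(1 − η₂)·2ⁿ` inputs, `η₂ > 0` the constant of `tripleElimHard`
(`ringWinU_twoWindows_le`).  Proof: `TwoWindowCharacters.lean` (27-cell parity obstruction over
the three block residues `X, Y, Z`), first-losing-cell decoder of degree `≤ 27(D + K)`
(`Smolensky.comp_mem_lowDeg_of_coord_mul`), and `tripleElimHard`.

The cell's statement (prover; a special case of crux α of route RingFrame); not in print.  With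
the two previous files: strategies using at most TWO interior clusters of `(log₂ n)^C`
consecutive walk characters (plus both ends) do not beat two-bit elimination by more than a
constant; the constants `η₀ ≥ η₁ ≥ η₂` come from iterating `elimHard_relative`.
WHAT THIS IS NOT: three or more interior windows, unbalanced blocks, or dense supports (the
compounding question of the crux) are untouched; nothing on `LDMAPolylog`, `TRPlus` or α in
general; no separation.
-/

noncomputable section

namespace Summit.QuantumAdvantage.AdviceFreeQNC0

open Finset
open Literature.Computability.MetaComplexity Literature.Computability.MetaComplexity.Smolensky

variable {L₀ L₁ L₂ : ℕ}

/-! ### Block weights of `u : {0,1}^{L₀ + (L₁ + L₂)}` -/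

/-- The weight of the middle block is `W_{L₀+L₁}(u) − W_{L₀}(u)`. [folklore] -/
theorem wt_mid_eq_sub (u : Fin (L₀ + (L₁ + L₂)) → Bool) :
    wt (fun j : Fin L₁ => u (Fin.natAdd L₀ (Fin.castAdd L₂ j))) =
      wtPrefix u (L₀ + L₁) - wtPrefix u L₀ := by
  have hx : wtPrefix u L₀ = wt (fun i : Fin L₀ => u (Fin.castAdd (L₁ + L₂) i)) :=
    (wt_left_eq_wtPrefix u).symm
  have hmid : wtPrefix u (L₀ + L₁) = wt (fun i : Fin L₀ => u (Fin.castAdd (L₁ + L₂) i)) +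
      wtPrefix (fun k : Fin (L₁ + L₂) => u (Fin.natAdd L₀ k)) L₁ := by
    conv_lhs => rw [← Fin.append_castAdd_natAdd (f := u)]
    rw [wtPrefix_append_of_ge _ _ (Nat.le_add_right L₀ L₁), Nat.add_sub_cancel_left]
  have hz₁ : wtPrefix (fun k : Fin (L₁ + L₂) => u (Fin.natAdd L₀ k)) L₁ =
      wt (fun j : Fin L₁ => u (Fin.natAdd L₀ (Fin.castAdd L₂ j))) :=
    (wt_left_eq_wtPrefix (fun k : Fin (L₁ + L₂) => u (Fin.natAdd L₀ k))).symm
  rw [hmid, hx, hz₁]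
  omega

/-- The weight of the last block is `|u| − W_{L₀+L₁}(u)`. [folklore] -/
theorem wt_last_eq_sub (u : Fin (L₀ + (L₁ + L₂)) → Bool) :
    wt (fun j : Fin L₂ => u (Fin.natAdd L₀ (Fin.natAdd L₁ j))) = wt u - wtPrefix u (L₀ + L₁) := by
  have hz : wt (fun k : Fin (L₁ + L₂) => u (Fin.natAdd L₀ k)) = wt u - wtPrefix u L₀ :=
    wt_right_eq_sub u
  have hz₂ : wt (fun j : Fin L₂ => u (Fin.natAdd L₀ (Fin.natAdd L₁ j))) =
      wt (fun k : Fin (L₁ + L₂) => u (Fin.natAdd L₀ k)) -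
        wtPrefix (fun k : Fin (L₁ + L₂) => u (Fin.natAdd L₀ k)) L₁ :=
    wt_right_eq_sub (fun k : Fin (L₁ + L₂) => u (Fin.natAdd L₀ k))
  have hz₁ : wtPrefix (fun k : Fin (L₁ + L₂) => u (Fin.natAdd L₀ k)) L₁ =
      wtPrefix u (L₀ + L₁) - wtPrefix u L₀ := by
    rw [← wt_mid_eq_sub u]
    exact (wt_left_eq_wtPrefix (fun k : Fin (L₁ + L₂) => u (Fin.natAdd L₀ k))).symm
  have hmono : wtPrefix u L₀ ≤ wtPrefix u (L₀ + L₁) := by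
    rw [wtPrefix_eq_add_midCount u (Nat.le_add_right L₀ L₁)]; omega
  have hle : wtPrefix u (L₀ + L₁) ≤ wt u := by
    have := wtPrefix_add_wtSuffix u (L₀ + L₁); omega
  rw [hz₂, hz, hz₁]
  omega

/-! ### Degree budget -/

/-- `108·(log₂ n)^C ≤ m^{2C+2}` for `m = log₂ min ≥ 11` and `log₂ n ≤ 2m`. [folklore] -/
theorem degree_budget108 (C : ℕ) {n m : ℕ} (hm : 11 ≤ m) (hbal : Nat.log 2 n ≤ 2 * m) :
    108 * (Nat.log 2 n) ^ C ≤ m ^ (2 * C + 2) := by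
  calc 108 * (Nat.log 2 n) ^ C ≤ 108 * (2 * m) ^ C := Nat.mul_le_mul_left _ (Nat.pow_le_pow_left hbal C)
    _ = 108 * (2 ^ C * m ^ C) := by rw [Nat.mul_pow]
    _ ≤ m ^ 2 * (m ^ C * m ^ C) := by
        have h1 : 108 ≤ m ^ 2 := by nlinarith
        have h2 : 2 ^ C ≤ m ^ C := Nat.pow_le_pow_left (by omega) C
        exact Nat.mul_le_mul h1 (Nat.mul_le_mul_right _ h2)
    _ = m ^ (2 * C + 2) := by rw [← pow_add, ← pow_add]; ring_nf

/-! ### The two-window theorem -/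

/-- **Ring strategies supported on the two ends and two interior windows win on at most
`(1 − η₂)·2ⁿ` inputs.**  For every `C` and all large, polynomially balanced blocks `L₀, L₁, L₂`
(`log₂ n ≤ 2 log₂ min(L₀,L₁,L₂)`, `n = L₀ + (L₁ + L₂)`): if `K ≤ (log₂ n)^C` and the walk
strategy `y` (selectors of degree `≤ (log₂ n)^C`) vanishes at every position `g ≥ K` outside
`[L₀, L₀+K) ∪ [L₀+L₁, L₀+L₁+K)` with `g + K ≤ n`, then for every charge the ring game is won on
at most `θ·2ⁿ` inputs, `θ = 1 − η₂ < 1`.  A special case of crux α (`RingHardU`).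
(Cell statement; 27-cell parity obstruction + decoder of degree `≤ 27((log₂ n)^C + K)` +
`tripleElimHard`.) [cite: Srinivasan2023, Lemma 3.1] -/
theorem ringWinU_twoWindows_le :
    ∃ θ : ℝ, θ < 1 ∧ ∀ C : ℕ, ∃ M₀ : ℕ, ∀ L₀ L₁ L₂ : ℕ, M₀ ≤ L₀ → M₀ ≤ L₁ → M₀ ≤ L₂ →
      Nat.log 2 (L₀ + (L₁ + L₂)) ≤ 2 * Nat.log 2 (min L₀ (min L₁ L₂)) →
      ∀ K : ℕ, K ≤ (Nat.log 2 (L₀ + (L₁ + L₂))) ^ C → ∀ c : ℕ,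
      ∀ y : Fin (L₀ + (L₁ + L₂) + 1) → (Fin (L₀ + (L₁ + L₂)) → Bool) → Bool,
        (∀ g, HasDeg (y g) ((Nat.log 2 (L₀ + (L₁ + L₂))) ^ C)) →
        (∀ g : Fin (L₀ + (L₁ + L₂) + 1), K ≤ g.val → (g.val < L₀ ∨ L₀ + K ≤ g.val) →
            (g.val < L₀ + L₁ ∨ L₀ + L₁ + K ≤ g.val) → g.val + K ≤ L₀ + (L₁ + L₂) →
            ∀ u, y g u = false) →
          ((univ.filter fun u : Fin (L₀ + (L₁ + L₂)) → Bool => ringWinU c y u = true).card : ℝ) ≤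
            θ * (2 : ℝ) ^ (L₀ + (L₁ + L₂)) := by
  classical
  obtain ⟨η₂, hη₂, cT, hcT, hT⟩ := tripleElimHard
  refine ⟨1 - η₂, by linarith, fun C => ?_⟩
  obtain ⟨M₁, hM₁⟩ := hT (2 * C + 2)
  obtain ⟨n₃, hn₃⟩ := logPow_le_sqrt' (2 * C + 2) (c₀ := cT / 2) (by positivity)
  refine ⟨max (max M₁ n₃) 2048, fun L₀ L₁ L₂ hL₀ hL₁ hL₂ hbal K hK c y hdeg hsupp => ?_⟩
  have hM₁L₀ : M₁ ≤ L₀ := le_trans (le_trans (le_max_left _ _) (le_max_left _ _)) hL₀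
  have hM₁L₁ : M₁ ≤ L₁ := le_trans (le_trans (le_max_left _ _) (le_max_left _ _)) hL₁
  have hM₁L₂ : M₁ ≤ L₂ := le_trans (le_trans (le_max_left _ _) (le_max_left _ _)) hL₂
  have hn₃L₁ : n₃ ≤ L₁ := le_trans (le_trans (le_max_right _ _) (le_max_left _ _)) hL₁
  have hn₃L₂ : n₃ ≤ L₂ := le_trans (le_trans (le_max_right _ _) (le_max_left _ _)) hL₂
  have h2048 : 2048 ≤ min L₀ (min L₁ L₂) :=
    le_min (le_trans (le_max_right _ _) hL₀) (le_min (le_trans (le_max_right _ _) hL₁)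
      (le_trans (le_max_right _ _) hL₂))
  set D := (Nat.log 2 (L₀ + (L₁ + L₂))) ^ C with hD
  -- degree budget: `27(D + K) ≤ m^(2C+2)`, `m = log₂ min`
  set m := Nat.log 2 (min L₀ (min L₁ L₂)) with hm
  have hm11 : 11 ≤ m := by
    have : Nat.log 2 2048 ≤ m := Nat.log_mono_right h2048
    have h11 : Nat.log 2 2048 = 11 := by
      rw [show (2048 : ℕ) = 2 ^ 11 by norm_num, Nat.log_pow (by norm_num)]
    omega
  have hbudget : 27 * (D + K) + 27 * (D + K) ≤ m ^ (2 * C + 2) := by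
    have := degree_budget108 C hm11 hbal
    have hKD : K ≤ D := hK
    omega
  have hmL₀ : m ^ (2 * C + 2) ≤ (Nat.log 2 L₀) ^ (2 * C + 2) :=
    Nat.pow_le_pow_left (Nat.log_mono_right (min_le_left _ _)) _
  have hmL₁ : m ^ (2 * C + 2) ≤ (Nat.log 2 L₁) ^ (2 * C + 2) :=
    Nat.pow_le_pow_left (Nat.log_mono_right (le_trans (min_le_right _ _) (min_le_left _ _))) _
  have hmL₂ : m ^ (2 * C + 2) ≤ (Nat.log 2 L₂) ^ (2 * C + 2) :=
    Nat.pow_le_pow_left (Nat.log_mono_right (le_trans (min_le_right _ _) (min_le_right _ _))) _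
  have hsqrt₁ : ((27 * (D + K) + 27 * (D + K) : ℕ) : ℝ) ≤ cT * Real.sqrt L₁ := by
    have h1 := hn₃ L₁ hn₃L₁
    have h2 : ((27 * (D + K) + 27 * (D + K) : ℕ) : ℝ) ≤ ((Nat.log 2 L₁ ^ (2 * C + 2) : ℕ) : ℝ) := by
      exact_mod_cast hbudget.trans hmL₁
    have h3 : (0 : ℝ) ≤ ((Nat.log 2 L₁ ^ (2 * C + 2) : ℕ) : ℝ) := by positivity
    linarith
  have hsqrt₂ : ((27 * (D + K) + 27 * (D + K) : ℕ) : ℝ) ≤ cT * Real.sqrt L₂ := by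
    have h1 := hn₃ L₂ hn₃L₂
    have h2 : ((27 * (D + K) + 27 * (D + K) : ℕ) : ℝ) ≤ ((Nat.log 2 L₂ ^ (2 * C + 2) : ℕ) : ℝ) := by
      exact_mod_cast hbudget.trans hmL₂
    have h3 : (0 : ℝ) ≤ ((Nat.log 2 L₂ ^ (2 * C + 2) : ℕ) : ℝ) := by positivity
    linarith
  -- local data of the characters
  let A : (Fin (L₀ + (L₁ + L₂)) → Bool) → Fin (L₀ + (L₁ + L₂) + 1) → ℕ := fun u g =>
    (if g.val < K then c + g.val + wtPrefix u g.val
    else if L₀ ≤ g.val ∧ g.val < L₀ + K then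
      c + g.val + (univ.filter fun i : Fin (L₀ + (L₁ + L₂)) => L₀ ≤ i.val ∧ i.val < g.val ∧ u i = true).card
    else if L₀ + L₁ ≤ g.val ∧ g.val < L₀ + L₁ + K then
      c + g.val + (univ.filter fun i : Fin (L₀ + (L₁ + L₂)) => L₀ + L₁ ≤ i.val ∧ i.val < g.val ∧ u i = true).card
    else c + g.val + 2 * (univ.filter fun i : Fin (L₀ + (L₁ + L₂)) => g.val ≤ i.val ∧ u i = true).card)
  let α : Fin (L₀ + (L₁ + L₂) + 1) → ℕ := fun g => (if g.val < K then 1 else 2)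
  let β : Fin (L₀ + (L₁ + L₂) + 1) → ℕ := fun g => (if g.val < K then 1 else if L₀ ≤ g.val ∧ g.val < L₀ + K then 1 else 2)
  let γ : Fin (L₀ + (L₁ + L₂) + 1) → ℕ := fun g =>
    (if g.val < K then 1 else if L₀ ≤ g.val ∧ g.val < L₀ + K then 1 else if L₀ + L₁ ≤ g.val ∧ g.val < L₀ + L₁ + K then 1 else 2)
  have hγ : ∀ g : Fin (L₀ + (L₁ + L₂) + 1), γ g % 3 ≠ 0 := by
    intro g
    by_cases h1 : g.val < K
    · simp [γ, h1]
    · by_cases h2 : L₀ ≤ g.val ∧ g.val < L₀ + K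
      · simp [γ, h1, h2]
      · by_cases h3 : L₀ + L₁ ≤ g.val ∧ g.val < L₀ + L₁ + K <;> simp [γ, h1, h2, h3]
  -- the hypothetical counts (Boolean form) and their parity bits
  let N : (Fin (L₀ + (L₁ + L₂)) → Bool) → ℕ → ℕ → ℕ → ℕ := fun u X' Y' Z' =>
    ((univ : Finset (Fin (L₀ + (L₁ + L₂) + 1))).filter fun g =>
      (y g u && decide ((A u g + α g * X' + β g * Y' + γ g * Z') % 3 ≠ 0)) = true).card
  let P : ℕ → ℕ → ℕ → (Fin (L₀ + (L₁ + L₂)) → Bool) → Bool := fun X' Y' Z' u =>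
    decide (N u X' Y' Z' % 2 = 1)
  have hNprop : ∀ u X' Y' Z', (univ.filter fun g : Fin (L₀ + (L₁ + L₂) + 1) => y g u = true ∧
      ((if g.val < K then c + g.val + wtPrefix u g.val
        else if L₀ ≤ g.val ∧ g.val < L₀ + K then
          c + g.val + (univ.filter fun i : Fin (L₀ + (L₁ + L₂)) => L₀ ≤ i.val ∧ i.val < g.val ∧ u i = true).card
        else if L₀ + L₁ ≤ g.val ∧ g.val < L₀ + L₁ + K then
          c + g.val + (univ.filter fun i : Fin (L₀ + (L₁ + L₂)) => L₀ + L₁ ≤ i.val ∧ i.val < g.val ∧ u i = true).card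
        else c + g.val + 2 * (univ.filter fun i : Fin (L₀ + (L₁ + L₂)) => g.val ≤ i.val ∧ u i = true).card) +
        (if g.val < K then 1 else 2) * X' +
        (if g.val < K then 1 else if L₀ ≤ g.val ∧ g.val < L₀ + K then 1 else 2) * Y' +
        (if g.val < K then 1 else if L₀ ≤ g.val ∧ g.val < L₀ + K then 1 else if L₀ + L₁ ≤ g.val ∧ g.val < L₀ + L₁ + K then 1 else 2) * Z') % 3 ≠ 0).card = N u X' Y' Z' := by
    intro u X' Y' Z'
    refine congrArg Finset.card ?_
    refine Finset.filter_congr fun g _ => ?_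
    rw [Bool.and_eq_true, decide_eq_true_iff]
  -- (1) the win bit
  have hwin : ∀ u, ringWinU c y u =
      P (wtPrefix u L₀) (wtPrefix u (L₀ + L₁) - wtPrefix u L₀) (wt u - wtPrefix u (L₀ + L₁)) u := by
    intro u
    rw [ringWinU_eq_windowCount3 c K L₀ (L₀ + L₁) (Nat.le_add_right L₀ L₁) y u,
      hNprop u (wtPrefix u L₀) (wtPrefix u (L₀ + L₁) - wtPrefix u L₀) (wt u - wtPrefix u (L₀ + L₁))]
  -- (2) residues only
  have hNmod : ∀ u X' Y' Z', N u X' Y' Z' = N u (X' % 3) (Y' % 3) (Z' % 3) := by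
    intro u X' Y' Z'
    rw [← hNprop, ← hNprop]
    exact windowCount3_mod c K L₀ (L₀ + L₁) y u X' Y' Z'
  -- (3) degree of the parity bits
  have hP : ∀ X' Y' Z', HasDeg (P X' Y' Z') (D + K) := fun X' Y' Z' =>
    hasDeg_windowParity3 c K L₀ (L₀ + L₁) y hdeg hsupp X' Y' Z'
  -- (4) encoding and decoder
  let e : (Fin (L₀ + (L₁ + L₂)) → Bool) → (Fin 27 → Bool) := fun u k =>
    P (k.val / 9) (k.val / 3 % 3) (k.val % 3) u
  let sel : (Fin 27 → Bool) → ℕ := fun q =>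
    if h : ∃ k : Fin 27, q k = false then (Fin.find (fun k => q k = false) h).val else 0
  have hsel_lt : ∀ q, sel q < 27 := by
    intro q
    by_cases h : ∃ k : Fin 27, q k = false
    · simp only [sel, dif_pos h]; exact Fin.isLt _
    · simp only [sel, dif_neg h]; norm_num
  have hsel_spec : ∀ q : Fin 27 → Bool, (∃ k, q k = false) → q ⟨sel q, hsel_lt q⟩ = false := by
    intro q h
    have hs : (⟨sel q, hsel_lt q⟩ : Fin 27) = Fin.find (fun k => q k = false) h := by
      apply Fin.ext; simp only [sel, dif_pos h]
    rw [hs]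
    exact Fin.find_spec h
  have he : ∀ k : Fin 27, (fun u => if e u k = true then (1 : ZMod 2) else 0) ∈
      lowDeg (ZMod 2) (L₀ + (L₁ + L₂)) (D + K) := fun k => hP _ _ _
  have hcomp : ∀ φ : (Fin 27 → Bool) → Bool,
      (fun u => if φ (e u) = true then (1 : ZMod 2) else 0) ∈
        lowDeg (ZMod 2) (L₀ + (L₁ + L₂)) (27 * (D + K)) := by
    intro φ
    exact Smolensky.comp_mem_lowDeg_of_coord_mul (F := ZMod 2) e he (hasDeg_self φ)
  let a₀ : CubeFn (ZMod 2) (L₀ + (L₁ + L₂)) := fun u => if decide (sel (e u) / 9 = 1) = true then 1 else 0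
  let b₀ : CubeFn (ZMod 2) (L₀ + (L₁ + L₂)) := fun u => if decide (sel (e u) / 9 = 2) = true then 1 else 0
  let a₁ : CubeFn (ZMod 2) (L₀ + (L₁ + L₂)) := fun u => if decide (sel (e u) / 3 % 3 = 1) = true then 1 else 0
  let b₁ : CubeFn (ZMod 2) (L₀ + (L₁ + L₂)) := fun u => if decide (sel (e u) / 3 % 3 = 2) = true then 1 else 0
  let a₂ : CubeFn (ZMod 2) (L₀ + (L₁ + L₂)) := fun u => if decide (sel (e u) % 3 = 1) = true then 1 else 0
  let b₂ : CubeFn (ZMod 2) (L₀ + (L₁ + L₂)) := fun u => if decide (sel (e u) % 3 = 2) = true then 1 else 0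
  let dec : ZMod 2 → ZMod 2 → ℕ := fun p q => if p = 1 then 1 else if q = 1 then 2 else 0
  have hdec_val : ∀ t : ℕ, t < 3 →
      dec (if decide (t = 1) = true then 1 else 0) (if decide (t = 2) = true then 1 else 0) = t := by
    intro t ht
    interval_cases t <;> simp [dec]
  -- (5) `tripleElimHard`
  have hD27 : 27 * (D + K) ≤ (Nat.log 2 L₀) ^ (2 * C + 2) := by
    have := hbudget.trans hmL₀; omega
  have hJoint := hM₁ L₀ L₁ L₂ hM₁L₀ hM₁L₁ hM₁L₂ (27 * (D + K)) hD27 hsqrt₁ hsqrt₂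
    a₀ b₀ a₁ b₁ a₂ b₂
    (hcomp fun q => decide (sel q / 9 = 1)) (hcomp fun q => decide (sel q / 9 = 2))
    (hcomp fun q => decide (sel q / 3 % 3 = 1)) (hcomp fun q => decide (sel q / 3 % 3 = 2))
    (hcomp fun q => decide (sel q % 3 = 1)) (hcomp fun q => decide (sel q % 3 = 2)) dec dec dec
  -- (6) where all three decoders are right, the strategy loses
  have hlose : (univ.filter fun u : Fin (L₀ + (L₁ + L₂)) → Bool =>
      dec (a₀ u) (b₀ u) % 3 = Hegedus.wt (fun i : Fin L₀ => u (Fin.castAdd (L₁ + L₂) i)) % 3 ∧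
      dec (a₁ u) (b₁ u) % 3 =
        Hegedus.wt (fun j : Fin L₁ => u (Fin.natAdd L₀ (Fin.castAdd L₂ j))) % 3 ∧
      dec (a₂ u) (b₂ u) % 3 =
        Hegedus.wt (fun j : Fin L₂ => u (Fin.natAdd L₀ (Fin.natAdd L₁ j))) % 3) ⊆
      univ.filter fun u : Fin (L₀ + (L₁ + L₂)) → Bool => ¬ ringWinU c y u = true := by
    intro u hu
    rw [mem_filter] at hu
    obtain ⟨-, h0, h1, h2⟩ := hu
    rw [mem_filter]
    refine ⟨mem_univ _, ?_⟩
    have hsel0 : dec (a₀ u) (b₀ u) = sel (e u) / 9 :=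
      hdec_val (sel (e u) / 9) (by have := hsel_lt (e u); omega)
    have hsel1 : dec (a₁ u) (b₁ u) = sel (e u) / 3 % 3 :=
      hdec_val (sel (e u) / 3 % 3) (Nat.mod_lt _ (by norm_num))
    have hsel2 : dec (a₂ u) (b₂ u) = sel (e u) % 3 :=
      hdec_val (sel (e u) % 3) (Nat.mod_lt _ (by norm_num))
    have hex : ∃ k : Fin 27, e u k = false := by
      obtain ⟨X₀, Y₀, Z₀, hX₀, hY₀, hZ₀, heven⟩ := exists_windowCount3_even
        ((univ : Finset (Fin (L₀ + (L₁ + L₂) + 1))).filter fun g => y g u = true) (A u) α β γ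
        (fun g _ => hγ g)
      have hNN : (((univ : Finset (Fin (L₀ + (L₁ + L₂) + 1))).filter fun g => y g u = true).filter
          fun g => (A u g + α g * X₀ + β g * Y₀ + γ g * Z₀) % 3 ≠ 0).card = N u X₀ Y₀ Z₀ := by
        rw [Finset.filter_filter]; exact hNprop u X₀ Y₀ Z₀
      rw [hNN] at heven
      refine ⟨⟨9 * X₀ + 3 * Y₀ + Z₀, by omega⟩, ?_⟩
      have hk1 : (9 * X₀ + 3 * Y₀ + Z₀) / 9 = X₀ := by omega
      have hk2 : (9 * X₀ + 3 * Y₀ + Z₀) / 3 % 3 = Y₀ := by omega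
      have hk3 : (9 * X₀ + 3 * Y₀ + Z₀) % 3 = Z₀ := by omega
      show decide (N u ((9 * X₀ + 3 * Y₀ + Z₀) / 9) ((9 * X₀ + 3 * Y₀ + Z₀) / 3 % 3)
        ((9 * X₀ + 3 * Y₀ + Z₀) % 3) % 2 = 1) = false
      rw [hk1, hk2, hk3, decide_eq_false_iff_not]
      omega
    have hspec : decide (N u (sel (e u) / 9) (sel (e u) / 3 % 3) (sel (e u) % 3) % 2 = 1) = false :=
      hsel_spec (e u) hex
    rw [decide_eq_false_iff_not] at hspec
    have hX : Hegedus.wt (fun i : Fin L₀ => u (Fin.castAdd (L₁ + L₂) i)) = wtPrefix u L₀ :=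
      wt_left_eq_wtPrefix u
    have hY : Hegedus.wt (fun j : Fin L₁ => u (Fin.natAdd L₀ (Fin.castAdd L₂ j))) =
        wtPrefix u (L₀ + L₁) - wtPrefix u L₀ := wt_mid_eq_sub u
    have hZ : Hegedus.wt (fun j : Fin L₂ => u (Fin.natAdd L₀ (Fin.natAdd L₁ j))) =
        wt u - wtPrefix u (L₀ + L₁) := wt_last_eq_sub u
    have hlt3 : sel (e u) / 9 < 3 := by have := hsel_lt (e u); omega
    have h0' : sel (e u) / 9 = wtPrefix u L₀ % 3 := by
      have h := h0
      rw [hsel0, hX, Nat.mod_eq_of_lt hlt3] at h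
      exact h
    have h1' : sel (e u) / 3 % 3 = (wtPrefix u (L₀ + L₁) - wtPrefix u L₀) % 3 := by
      have h := h1
      rw [hsel1, hY, Nat.mod_mod] at h
      exact h
    have h2' : sel (e u) % 3 = (wt u - wtPrefix u (L₀ + L₁)) % 3 := by
      have h := h2
      rw [hsel2, hZ, Nat.mod_mod] at h
      exact h
    rw [hwin u]
    simp only [P, decide_eq_true_eq]
    rw [hNmod, ← h0', ← h1', ← h2']
    exact hspec
  -- (7) count
  have hcount : ((univ.filter fun u : Fin (L₀ + (L₁ + L₂)) → Bool => ringWinU c y u = true).card : ℝ) +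
      ((univ.filter fun u : Fin (L₀ + (L₁ + L₂)) → Bool => ¬ ringWinU c y u = true).card : ℝ) =
        (2 : ℝ) ^ (L₀ + (L₁ + L₂)) := by
    have h := Finset.card_filter_add_card_filter_not
      (s := (univ : Finset (Fin (L₀ + (L₁ + L₂)) → Bool))) (fun u => ringWinU c y u = true)
    rw [Finset.card_univ, Fintype.card_fun, Fintype.card_bool, Fintype.card_fin] at h
    exact_mod_cast h
  have hge : η₂ * (2 : ℝ) ^ (L₀ + (L₁ + L₂)) ≤
      ((univ.filter fun u : Fin (L₀ + (L₁ + L₂)) → Bool => ¬ ringWinU c y u = true).card : ℝ) :=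
    hJoint.trans (by exact_mod_cast Finset.card_le_card hlose)
  linarith

end Summit.QuantumAdvantage.AdviceFreeQNC0
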